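import Mathlib
import HarnessLib
import HarnessLib.Audit
import Summits.ABC.ABC.Statement
import HarnessLib.Audit.Status.Attr

/-!
Route: BelyiSqueeze

CLOSED (refuted) 2026-08-15T16:23:09Z by planner-rrefute-ABC-BelyiSqueeze-stmt-ABC-1205-cab21a39-g4-0 — reason: refuted:stmt-ABC-1205 (DegBelyiLower) by Summit.ABC.ABC.Theorems.BelyiSqueezeDegBelyiLower_refuted — note: substantive (harness label 'misstated' is heuristic; decl audited exact by two refuters, witness is an honest genus-0 Belyi map over Q, no degeneracy). Summit.ABC.ABC.Theorems.BelyiSqueezeDegBelyiLower_refuted: square family (1,d^2-1,d^2), d odd, has Belyi witnesses of degree d = sqrt(c) (phi_m = (-. The file is kept as the record of this route; refuted decls are indexed as negative knowledge (`ledger negatives`).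

Route for idea card ABC/ABC/belyi-szpiro-squeeze ("Belyi–Szpiro squeeze"), in the sharpened two-crux
form its triage asked for. Let deg_B(λ) denote the Belyi degree of the four-pointed line (ℙ¹; 0, 1,
∞, λ): the least degree of a finite map φ : ℙ¹ → ℙ¹ over ℂ (equivalently over ℚ̄) unramified outside
{0,1,∞} with φ({0,1,∞,λ}) ⊆ {0,1,∞}. For an abc triple a + b = c, Belyi's polynomial β_{a,b}(t) =
c^c t^a (1−t)^b / (a^a b^b) has degree c and sends {0,1,∞,a/c} into {0,1,∞}, so deg_B(a/c) ≤ c;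
Beckmann–Zapponi–Rodriguez give only deg_B(a/c) ≥ P(abc) (largest prime factor).
THESIS X ("it suffices to show"): X := DegBelyiLower ∧ DegBelyiRadical, where
 • DegBelyiLower (anti-Belyi, crux rank 2): ∀ ε > 0 ∃ C_ε ∀ abc triples, c ≤ C_ε · deg_B(a/c)^{1+ε}
— Belyi's elementary construction is optimal up to c^{o(1)} for a rational fourth point. It is the
genus-0 shadow of the LOGARITHMIC form h_F(E) ≤ (½+ε)·log deg_B(E) + C_ε of Javanpeykar's proved
h_F(E) ≤ 13·10⁶·deg_B(E)⁵ (Javanpeykar2014 Thm 1.1.1), read on Frey curves (deg_B(E_{a,b,c}) ≤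
2·deg_B(a/c), h_F(E_{a,b,c}) = ½ log c + O(log log c)).
 • DegBelyiRadical (conductor-effective Belyi, crux rank 3): ∀ ε > 0 ∃ C_ε ∀ abc triples, deg_B(a/c)
≤ C_ε · rad(abc)^{1+ε} — a dessin of size radical^{1+ε}, not height, already draws the configuration
{0,1,∞,a/c}.
X → ABC is the squeeze c ≤ C₁·deg_B^{1+ε/3} ≤ C₁(C₂·rad^{1+ε/3})^{1+ε/3} < C·rad(abc)^{1+ε} (rad ≥
1), i.e. Bombieri–Gubler Conj. 12.2.2 = `ABC`.
Lean (route file, namespace Summit.ABC.ABC.Theses.BelyiSqueeze): `Assembly : DegBelyiLower →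
DegBelyiRadical → ABC`, over `Literature.NumberTheory.DiophantineGeometry.IsABCTriple` / `.rad` and
root constant `ABC`; "deg_B(a/c) ≤ n is witnessed in degree n" is INLINED (Mathlib has no Belyi
maps) as: ∃ P Q : Polynomial ℂ, ∃ x y z w : ℂ, IsCoprime P Q ∧ P.natDegree = Q.natDegree = (P −
Q).natDegree = n ∧ (P·Q·(P−Q)).roots.toFinset.card = n + 2 ∧ {x,y,z,w} are 4 distinct such roots ∧
(w−x)(y−z) = (a/c)·(w−z)(y−x). Justification: change the source coordinate so that ∞ ∉ φ⁻¹{0,1,∞}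
(then P, Q, P−Q all have exact degree n and the marked points are four affine fibre points with
cross-ratio CR(x,y;z,w) = ((w−x)(y−z))/((w−z)(y−x)) = a/c); by Riemann–Hurwitz the fibre φ⁻¹{0,1,∞}
= roots of P·Q·(P−Q) has ≥ n + 2 points with equality iff φ = P/Q is unramified outside {0,1,∞}
(Goldring2011 Thm 3.2 / (3.0.15): the equality case of Mason–Stothers is exactly "Belyi").

Rationale: WHY THIS LINE. Conductor, discriminant and height are traded for ONE combinatorial invariant, the
Belyi degree of the pointed line (ℙ¹; 0,1,∞,a/c) — a dessin d'enfant edge count — and abc becomes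
the squeeze c^{1−o(1)} ≤ deg_B(a/c) ≤ rad(abc)^{1+o(1)}. Imports: Belyi maps/dessins and good
reduction of covers (Beckmann1989 Prop 5.3, Zapponi2009BelyiDegree Thm 1.3, Rodriguez2013 Thm 3:
every prime of abc is ≤ deg_B(a/c)); Arakelov theory of Belyi curves (Javanpeykar2014 Thm 1.1.1: the
Faltings height is POLYNOMIAL in deg_B — crux 2 is its conjectural LOGARITHMIC sharpening in genus
0, exponent pinned to 1 by Frey curves); effective Belyi (Belyi1980; Khadjavi2002 Thm 1.1: degree
bounds exponential in the height); Belyi maps over ℚ with prescribed small bad-reduction sets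
(Roberts2018, Hurwitz–Belyi maps of degree in the thousands ramified within {2,3,5}) as the toolbox
for crux 3. Prior uses of Belyi maps near abc run the other way (Elkies1991ABCMordell,
MochizukiGenEll2010: Belyi maps inside reductions FROM abc). Moves: reformulation + invariant hunt —
deg_B is a height-like counting function (Goldring2011 Question 2.7 asks for its behaviour; Thm 3.2
there, Belyi = equality in Mason–Stothers, is how it is inlined in Lean) that no abc engine has
exploited.
RANKED CRUXES. (2) DegBelyiLower, c ≤ C_ε·deg_B(a/c)^{1+ε} — hardest, most informative: a rigidity
statement "no cheap dessin through a rational point of large height"; tools: Arakelov–Green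
functions on Belyi covers of X(2) (Javanpeykar/Merkl; sup-norm bounds logarithmic in the degree),
heights of Belyi maps vs degree, Beckmann's smoothness constraint. (3) DegBelyiRadical, deg_B(a/c) ≤
C_ε·rad(abc)^{1+ε} — constructive: per triple, a Belyi map of degree ≤ C_ε rad^{1+ε} whose
{0,1,∞}-fibre holds four points of cross-ratio a/c (compositions of t ↦ t^p for p | abc, t ↦ 1−t,
Chebyshev/dihedral/Lattès pieces, Hurwitz–Belyi maps with bad reduction inside Supp(2abc)). Implied
by ABC (deg_B ≤ c via β_{a,b}): a necessary condition reached through a constructive door; given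
crux 2 it is equivalent to ABC.
SUPPORT (rank 9, staffable now): BelyiWitnessLeC — β_{a,b} gives a witness of degree ≤ c (its
{0,1,∞}-fibre: 0, 1, ∞, a/c and the c−2 simple roots of c^c t^a(1−t)^b = a^a b^b; move ∞ off the
fibre by a Möbius change of coordinate); PolyAntiBelyi — c ≤ C·deg_B(a/c)^K for some K, first rung
of crux 2 (with crux 3: a polynomial abc bound, open, not the summit). Assembly (rank 1):
real-exponent bookkeeping (both cruxes at ε/3; (1+ε/3)² ≤ 1+ε for ε ≤ 1, monotonicity in ε
otherwise; rad ≥ 1; constant +1 for strictness). No Target item: X is literally Crux₂ ∧ Crux₃.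
KILL CRITERIA. (i) An infinite family of triples with Belyi witnesses of degree d and c ≥ d^{1+δ}
(fixed δ > 0) refutes crux 2 and closes the route. Sporadically c = d²: deg_B(1/9) = 3 via the T₃
dessin β = (1+T₃)/2 (fibre {±1, ±½, ∞}; CR(−1,−½;½,1) = −8, in the orbit of 1/9, triple (1,8,9));
H(4) = 3 (Rodriguez2013 Ex. 5, triple (1,3,4)). Card belyi-degree-smooth-regime conjectures exactly
such a family (deg_B(a/c) ≤ C·P(abc)^K), so ONE dessin census — genus-0 dessins of degree ≤ 9
(LMFDB) resp. ≤ 14 (kit: permutation triples + Gröbner), rational 4-subsets of their {0,1,∞}-fibres,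
triples realised — tests both cards and belongs as evidence on DegBelyiLower. (ii) Crux 3 is implied
by ABC: it dies only with ABC or through a NEW lower-bound technology for deg_B beating the radical
on infinitely many triples (Beckmann's floor P(abc) ≤ rad never can). (iii) If deg_B(a/c) = c
identically, crux 3 is verbatim ABC and the route is vacuous — (i) already shows deg_B(a/c) < c
occurs; refuters should quantify how often.
NOT DECOMPOSED YET (earned by splits): crux 2 into (a) coefficient height of a degree-d Belyi map
through four rational points ≪_ε d^{1+ε}, (b) the Arakelov form on X(2)-covers, (c) the Frey
transfer deg_B(E_{abc}) ≤ 2 deg_B(a/c), 12 h_F ≥ log|Δ_min| − O(log log), recovering the card's (BS)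
for semistable E/ℚ; crux 3 into smooth vs large-prime regimes. Filed with the route: definition
request `belyiDegree` (four-pointed ℙ¹ / λ ∈ ℚ̄; shared with card belyi-degree-smooth-regime); fact
request: the Beckmann–Zapponi–Rodriguez floor. Search log for Novelty/Barriers: lit search "Belyi
degree" (local+zbMATH+Crossref), --hybrid, lit galaxy search --star all (+1 bm25/pdf); read
Goldring2011 pp.191–195, Rodriguez2013, Zapponi2009 §1, Khadjavi2002 §1, Javanpeykar2014 §1,
Roberts2018 §1.

Novelty: Nearest prior art (searched, read): Javanpeykar2014 (arXiv:1403.6404) Thm 1.1.1, h_F ≤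
13·10⁶·g·deg_B⁵, and §1.4 "one could replace Arakelov invariants by the Belyi degree" — polynomial,
no logarithmic conjecture, no abc squeeze; Zapponi2009BelyiDegree Thm 1.3 / Beckmann1989 Prop 5.3 /
Rodriguez2013 Thm 3 — deg_B ≥ bad primes, Rodriguez's "Belyi height" with H(4) = 3 and the open
question "express H in closed form"; Liţcanu 2004 doi:10.1007/s00605-003-0142-2 and Khadjavi2002 Thm
1.1 — upper bounds through heights; Goldring2011 Question 2.7 (behaviour of the Belyi-degree
function), Thm 3.2 (Belyi = equality in Mason–Stothers); Roberts2018 — Belyi maps over ℚ with small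
bad-reduction sets; card belyi-degree-smooth-regime — the opposite, polynomial-in-P(abc) bet. Not
found anywhere: (i) the anti-Belyi conjecture c ≤ C_ε·deg_B(a/c)^{1+ε} (Belyi's construction optimal
up to c^{o(1)} for a rational fourth point), nor its parent, logarithmic Javanpeykar with the
constant ½ forced by Frey curves; (ii) the conductor-effective Belyi conjecture deg_B(a/c) ≤
C_ε·rad(abc)^{1+ε}; (iii) the squeeze (i) ∧ (ii) ⟹ abc with exponent 1+ε. Delta in one sentence: a
known invariant — the Belyi degree of a four-pointed line — is placed between c and rad(abc), and
LOGARITHMIC instead of polynomial height dependence is what lets a Belyi-degree route reach 1+ε.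
Expected grade: new-combination (triage 2026-08-15 concurred).  [refs: 10.1007/s00605-003-0142-2, 1403.6404, doi:10.1007/s00605-003-0142-2, Javanpeykar2014, Beckmann1989, Rodriguez2013, Khadjavi2002, Goldring2011, Roberts2018]

Barriers (technique_class: belyi-degree dessins riemann-hurwitz-transfer arakelov-height): - Literature.Barriers.ABC.IntegersHaveNoDerivation: Riemann–Hurwitz/Mason–Stothers are applied only
to honest maps ℙ¹_ℂ → ℙ¹_ℂ, to DEFINE "Belyi of degree n" as the equality case (Goldring2011 Thm
3.2); nothing is differentiated over ℤ; ℤ is reached via heights/Arakelov theory of covers (crux 2)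
and reduction of covers mod p (Beckmann1989); the ε-free polynomial-shaped inequality is not a
target (both cruxes are ∀ε ∃C_ε).
- Literature.Barriers.ABC.EpsilonCannotBeDropped,
Literature.Barriers.ABC.SzpiroEpsilonCannotBeDropped: with ε = 0 in both cruxes the squeeze gives c
≤ C·rad, refuted (Stewart–Tijdeman): at least one crux needs its ε; both carry it.
- Literature.Barriers.ABC.ExplicitABCQualityFloor: no explicit/constant-one claim; Reyssat's triple
only constrains C_ε.
- Literature.Barriers.ABC.BakerMethodBounds: no linear forms in logs; Baker-type floors (P(abc) ≫
log log c) only benchmark crux 2.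
- Literature.Barriers.ABC.MasonStothersFailsInCharP: no char-p transfer; reduction mod p enters only
as good reduction of tame covers at p > deg (Beckmann), where separability holds.
- Literature.Barriers.ABC.UniformABCImpliesNoSiegelZeros: everything is over ℚ (rational
cross-ratios a/c); no number-field uniformity claimed.
Honest bet: no catalogued barrier bites; the uncatalogued obstruction is that every known lower
bound for deg_B(a/c) is logarithmic in c (bad primes ≤ deg_B; coefficient heights ≪ d·log d), so
crux 2 needs a new rigidity mechanism for dessins.

History (route lifecycle, newest last):
- 2026-08-15T14:03:10Z · BROKEN — DegBelyiLower (stmt-ABC-1205, crux) refuted by Summit.ABC.ABC.Theorems.BelyiSqueezeDegBelyiLower_refuted @ 1092fc2bb301 (refuter-rreview-route-ABC-BelyiSqueeze-r-ee9464b7-0)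
- 2026-08-15T16:23:10Z · CLOSED refuted — refuted:stmt-ABC-1205 (DegBelyiLower) by Summit.ABC.ABC.Theorems.BelyiSqueezeDegBelyiLower_refuted (planner-rrefute-ABC-BelyiSqueeze-stmt-ABC-1205-cab21a39-g4-0)

sub-problem: ABC · status: closed(refuted) · opened planner-plancard-ABC-ABC-belyi-szpiro-squeeze-0a646bf2-0 2026-08-15T10:53:44Z · rev 2 · ledger route-ABC-BelyiSqueeze
GENERATED by the gate from the ledger (D-0016/17). Provers cite these decls: `theorem foo : Summit.ABC.ABC.Theses.BelyiSqueeze.<Decl> := …` in Summits/ABC/ABC/Theorems/<Name>.lean.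
-/

namespace Summit.ABC.ABC.Theses.BelyiSqueeze

open scoped BigOperators Topology Manifold Classical MeasureTheory ProbabilityTheory Matrix InnerProductSpace ComplexConjugate ContinuousMap
open Filter Set Function TopologicalSpace MeasureTheory

attribute [summit_statement] _root_.ABC

open Literature.Abc

/-- item stmt-ABC-1205 · crux · rank 2 · closed · refuted by Summit.ABC.ABC.Theorems.BelyiSqueezeDegBelyiLower_refuted @ 1092fc2bb301 (refuter) · by planner
why it might fail: Census (BelyiDB genus 0, all d<=7): every {2,3,5}-smooth abc triple has deg_B<=6 ((1,80,81) at d=5, (3,125,128) at d=6) and (64,125,189) at d=7, i.e. c ~ d^2.7 not d^(1+eps); proved floors: P(abc)<=d (Zapponi 1.3) and log c << d^5 (Javanpeykar 1.1.1); one family c>=d^(1+delta) kills it.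
sources: Javanpeykar2014, Zapponi2009BelyiDegree, Beckmann1989, Rodriguez2013, Khadjavi2002, arXiv:1805.07751
ANTI-BELYI LOWER BOUND: ∀ ε>0 ∃ C_ε>0 ∀ abc triples (a,b,c) ∀ n, if (ℙ¹; 0,1,∞,a/c) carries a Belyi
map of degree n then c ≤ C_ε·n^{1+ε}; i.e. deg_B(a/c) ≥ c^{1−ε'}/C' — Belyi's β_{a,b} (degree c) is
optimal up to c^{o(1)} for a rational fourth point. Genus-0 shadow of the conjectural LOGARITHMIC
Javanpeykar inequality h_F(E) ≤ (½+ε)·log deg_B(E) + C_ε for semistable E/ℚ (proved form: h_F ≤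
13·10⁶·g·deg_B⁵, Javanpeykar2014 Thm 1.1.1), read on Frey curves (deg_B(E_{a,b,c}) ≤ 2·deg_B(a/c),
h_F(E_{a,b,c}) = ½·log c + O(log log c)). Known today: deg_B(a/c) ≤ c (Belyi1980); floors: every
prime of abc is ≤ deg_B(a/c) (Beckmann1989 Prop 5.3, Zapponi2009BelyiDegree Thm 1.3, Rodriguez2013
Thm 3) and log c ≪ deg_B·log deg_B (coefficient heights, Khadjavi2002). Evidence wanted on this
item: a dessin census (genus-0 dessins of degree ≤ 9 from LMFDB / ≤ 14 by kit, rational 4-subsets of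
{0,1,∞}-fibres, triples realised) — it adjudicates this crux against card belyi-degree-smooth-regime
at once. witness predicate for deg_B(a/c) ≤ n in degree exactly n: ∃ P Q ∈ ℂ[X] coprime with deg P =
deg Q = deg(P−Q) = n (so φ = P/Q has degree n and ∞ ∉ φ⁻¹{0,1,∞}), #distinct roots of P·Q·(P−Q) =
n+2 (Riemann–H -/
@[route_item "route-ABC-BelyiSqueeze", crux]
def DegBelyiLower : Prop :=
  ∀ ε : ℝ, 0 < ε → ∃ C : ℝ, 0 < C ∧ ∀ a b c : ℕ, Literature.NumberTheory.DiophantineGeometry.IsABCTriple a b c → ∀ n : ℕ, (∃ P Q : Polynomial ℂ, ∃ x y z w : ℂ, IsCoprime P Q ∧ P.natDegree = n ∧ Q.natDegree = n ∧ (P - Q).natDegree = n ∧ (P * Q * (P - Q)).roots.toFinset.card = n + 2 ∧ ({x, y, z, w} : Finset ℂ).card = 4 ∧ {x, y, z, w} ⊆ (P * Q * (P - Q)).roots.toFinset ∧ (w - x) * (y - z) = ((a : ℂ) / (c : ℂ)) * ((w - z) * (y - x))) → (c : ℝ) ≤ C * (n : ℝ) ^ (1 + ε)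

/-- item stmt-ABC-1206 · crux · rank 3 · closed · moot by None · by planner
why it might fail: Implied by ABC (deg_B(a/c)<=c, Belyi1980; BG2006 Conj.12.2.2) and abc-equivalent given DegBelyiLower: unconditionally needs dessins of size rad^(1+eps) through every high-quality a/c and no construction is known (census d<=7: only sporadic S_5..S_7 dessins, c<=189); may be abc reworded.
sources: Belyi1980, BombieriGubler2006, Beckmann1989, Roberts2018, Khadjavi2002, arXiv:1805.07751
CONDUCTOR-EFFECTIVE BELYI: ∀ ε>0 ∃ C_ε>0 ∀ abc triples ∃ n ≤ C_ε·rad(abc)^{1+ε} such that (ℙ¹;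
0,1,∞,a/c) carries a Belyi map of degree n: a dessin of size radical^{1+ε}, not height, draws the
configuration. CONSTRUCTIVE target: compositions of t ↦ t^p (p | abc), t ↦ 1−t,
Chebyshev/dihedral/Lattès pieces; Belyi maps with bad reduction inside Supp(2abc) (Beckmann1989: bad
primes divide |Mon|; Roberts2018: Hurwitz–Belyi maps over ℚ ramified within {2,3,5} of degree in the
thousands). Implied by ABC (deg_B(a/c) ≤ c, item BelyiWitnessLeC) — a necessary condition for abc
reached through a different door; equivalent to ABC given DegBelyiLower. Prior Belyi-map uses near
abc go the other way (Elkies1991ABCMordell, MochizukiGenEll2010). witness predicate for deg_B(a/c) ≤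
n in degree exactly n: ∃ P Q ∈ ℂ[X] coprime with deg P = deg Q = deg(P−Q) = n (so φ = P/Q has degree
n and ∞ ∉ φ⁻¹{0,1,∞}), #distinct roots of P·Q·(P−Q) = n+2 (Riemann–Hurwitz: ≥ n+2 always, = iff φ is
unramified outside {0,1,∞}; Goldring2011 Thm 3.2 / (3.0.15)), and four distinct such roots x,y,z,w
with cross-ratio ((w−x)(y−z))/((w−z)(y−x)) = a/c (the marked points 0,1,∞,a/c after a Möbius change
of source coordinate). Ove -/
@[route_item "route-ABC-BelyiSqueeze"]
def DegBelyiRadical : Prop :=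
  ∀ ε : ℝ, 0 < ε → ∃ C : ℝ, 0 < C ∧ ∀ a b c : ℕ, Literature.NumberTheory.DiophantineGeometry.IsABCTriple a b c → ∃ n : ℕ, (n : ℝ) ≤ C * ((Literature.NumberTheory.DiophantineGeometry.rad a b c : ℕ) : ℝ) ^ (1 + ε) ∧ ∃ P Q : Polynomial ℂ, ∃ x y z w : ℂ, IsCoprime P Q ∧ P.natDegree = n ∧ Q.natDegree = n ∧ (P - Q).natDegree = n ∧ (P * Q * (P - Q)).roots.toFinset.card = n + 2 ∧ ({x, y, z, w} : Finset ℂ).card = 4 ∧ {x, y, z, w} ⊆ (P * Q * (P - Q)).roots.toFinset ∧ (w - x) * (y - z) = ((a : ℂ) / (c : ℂ)) * ((w - z) * (y - x))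

/-- item stmt-ABC-1208 · support · rank 9 · closed · moot by None · by planner
sources: Belyi1980, Goldring2011, Rodriguez2013
BELYI'S MAP (deg_B(a/c) ≤ c): for every abc triple there is a witness of degree n ≤ c (in fact n =
c): β_{a,b}(t) = c^c·t^a·(1−t)^b/(a^a·b^b) has critical points only at 0 (if a ≥ 2), 1 (if b ≥ 2),
a/c (β(a/c) = 1, simple critical point) and ∞, so its {0,1,∞}-fibre is {0, 1, ∞, a/c} ∪ {the c−2
other roots of c^c t^a(1−t)^b = a^a b^b, all simple}: c+2 points (equality in Mason–Stothers,
Goldring2011 Thm 3.2). To fit the witness predicate precompose with a Möbius σ sending ∞ to a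
non-fibre point (e.g. t = 1/u + 2 when β(2) ∉ {0,1}); P/Q := β∘σ then has deg P = deg Q = deg(P−Q) =
c and the images of 0,1,∞,a/c are four affine roots with cross-ratio a/c. This item makes
'DegBelyiRadical ⟸ ABC' formal and calibrates crux 2. Provable now (Polynomial.roots, derivative,
rootMultiplicity). witness predicate for deg_B(a/c) ≤ n in degree exactly n: ∃ P Q ∈ ℂ[X] coprime
with deg P = deg Q = deg(P−Q) = n (so φ = P/Q has degree n and ∞ ∉ φ⁻¹{0,1,∞}), #distinct roots of
P·Q·(P−Q) = n+2 (Riemann–Hurwitz: ≥ n+2 always, = iff φ is unramified outside {0,1,∞}; Goldring2011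
Thm 3.2 / (3.0.15)), and four distinct such roots x,y,z,w with cross-ratio ((w−x)(y−z))/((w−z)(y−x))
= a/c (the marked points 0,1,∞ -/
@[route_item "route-ABC-BelyiSqueeze"]
def BelyiWitnessLeC : Prop :=
  ∀ a b c : ℕ, Literature.NumberTheory.DiophantineGeometry.IsABCTriple a b c → ∃ n : ℕ, n ≤ c ∧ ∃ P Q : Polynomial ℂ, ∃ x y z w : ℂ, IsCoprime P Q ∧ P.natDegree = n ∧ Q.natDegree = n ∧ (P - Q).natDegree = n ∧ (P * Q * (P - Q)).roots.toFinset.card = n + 2 ∧ ({x, y, z, w} : Finset ℂ).card = 4 ∧ {x, y, z, w} ⊆ (P * Q * (P - Q)).roots.toFinset ∧ (w - x) * (y - z) = ((a : ℂ) / (c : ℂ)) * ((w - z) * (y - x))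

/-- item stmt-ABC-1209 · support · rank 9 · closed · moot by None · by planner
sources: Javanpeykar2014, Khadjavi2002, Zapponi2009BelyiDegree
POLYNOMIAL ANTI-BELYI (first rung of DegBelyiLower): ∃ K, C > 0 with c ≤ C·n^K for every Belyi
witness of degree n through a/c, i.e. log c ≪ log deg_B(a/c). Open: the known floors give only log c
≪ deg_B⁵ (Javanpeykar2014 Thm 1.1.1 via Frey curves) resp. log c ≪ deg_B·log deg_B (coefficient
heights of Belyi maps, Khadjavi2002) and primes of abc ≤ deg_B (Zapponi2009BelyiDegree Thm 1.3).
Together with DegBelyiRadical it yields a polynomial abc bound c ≤ C'·rad(abc)^{K(1+ε)} (cf.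
Literature.NumberTheory.DiophantineGeometry.WeakABCConjecture for K(1+ε) ≤ 2) — NOT the summit;
filed as the natural waypoint and as the statement the Arakelov method could plausibly reach first.
witness predicate for deg_B(a/c) ≤ n in degree exactly n: ∃ P Q ∈ ℂ[X] coprime with deg P = deg Q =
deg(P−Q) = n (so φ = P/Q has degree n and ∞ ∉ φ⁻¹{0,1,∞}), #distinct roots of P·Q·(P−Q) = n+2
(Riemann–Hurwitz: ≥ n+2 always, = iff φ is unramified outside {0,1,∞}; Goldring2011 Thm 3.2 /
(3.0.15)), and four distinct such roots x,y,z,w with cross-ratio ((w−x)(y−z))/((w−z)(y−x)) = a/c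
(the marked points 0,1,∞,a/c after a Möbius change of source coordinate). Over ℂ = over ℚ̄ (Belyi
maps descend; the normalising Möbius ma -/
@[route_item "route-ABC-BelyiSqueeze"]
def PolyAntiBelyi : Prop :=
  ∃ K C : ℝ, 0 < C ∧ ∀ a b c : ℕ, Literature.NumberTheory.DiophantineGeometry.IsABCTriple a b c → ∀ n : ℕ, (∃ P Q : Polynomial ℂ, ∃ x y z w : ℂ, IsCoprime P Q ∧ P.natDegree = n ∧ Q.natDegree = n ∧ (P - Q).natDegree = n ∧ (P * Q * (P - Q)).roots.toFinset.card = n + 2 ∧ ({x, y, z, w} : Finset ℂ).card = 4 ∧ {x, y, z, w} ⊆ (P * Q * (P - Q)).roots.toFinset ∧ (w - x) * (y - z) = ((a : ℂ) / (c : ℂ)) * ((w - z) * (y - x))) → (c : ℝ) ≤ C * (n : ℝ) ^ K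

/-- item stmt-ABC-1207 · assembly · rank 1 · closed · moot by None · by planner
sources: BombieriGubler2006
THE SQUEEZE: DegBelyiLower → DegBelyiRadical → ABC. Given ε > 0 put ε' = min(ε,1)/3 and take C₁
(crux 2 at ε') and C₂ (crux 3 at ε'): for a triple, crux 3 gives a witness degree n ≤ C₂·rad^{1+ε'},
crux 2 gives c ≤ C₁·n^{1+ε'} ≤ C₁·C₂^{1+ε'}·rad^{(1+ε')²} ≤ C₁·C₂^{1+ε'}·rad^{1+ε} (rad ≥ 1 as a
natural-number radical of abc ≥ 2; (1+ε')² ≤ 1+ε), hence c < (C₁·C₂^{1+ε'} + 1)·rad^{1+ε}. Pure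
Real.rpow bookkeeping (Real.rpow_le_rpow_left_iff / rpow_natCast / mul_rpow); staffable now.
Sources: BombieriGubler2006 Conj. 12.2.2 (= ABC). -/
@[route_item "route-ABC-BelyiSqueeze"]
def Assembly : Prop :=
  DegBelyiLower → DegBelyiRadical → ABC

end Summit.ABC.ABC.Theses.BelyiSqueeze
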